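import Summits.HodgeConjecture.HodgeCM.Literature.NormTheorem_1

/-! PORT of `HodgeCM/Literature/NormTheorem.lean` (HodgeCMPerL run 82) — part 2: continuation of `Summits.HodgeConjecture.HodgeCM.Literature.NormTheorem_1` (split at a top-level declaration boundary by port_pkg.py; scope re-opened below; declarations unchanged). -/

-- port_pkg: scope re-opened for this part (file-level context, then the namespace/section stack open at the cut)
noncomputable section
open NumberField
open scoped Matrix
namespace HodgeCM
namespace Literature
open _root_.Literature.AlgebraicGeometry.ShimuraVarieties (conjRingHomK embedding_conjRingHomK)
/-- Landherr's classification of diagonal hermitian PLANES over a CM field (isometric iff same signs at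
every complex embedding and same discriminant class mod norms), as an `iff`, from the one cited theorem
`Vigneras_III_4_1` (sufficiency) and run 15's unconditional `lemma33bLandherr_converse` (necessity). -/
theorem landherr_rank2_iff_of_normTheorem (hNT : Vigneras_III_4_1) (L : CMField)
    (a : Fin 4 → L) (ha : ∀ i, conjRingHomK L (a i) = a i) (ha0 : ∀ i, a i ≠ 0) :
    (∃ g : GL (Fin 2) L,
      ((g : Matrix (Fin 2) (Fin 2) L).transpose.map (conjRingHomK L)) * Matrix.diagonal ![a 0, a 1] *
        (g : Matrix (Fin 2) (Fin 2) L) = Matrix.diagonal ![a 2, a 3]) ↔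
    ((∀ τ : L →+* ℂ,
      ({decide (0 < (τ (a 0)).re), decide (0 < (τ (a 1)).re)} : Multiset Bool) =
        {decide (0 < (τ (a 2)).re), decide (0 < (τ (a 3)).re)}) ∧
    ∃ z : L, z ≠ 0 ∧ a 0 * a 1 = a 2 * a 3 * (z * conjRingHomK L z)) :=
  ⟨fun hiso => lemma33bLandherr_converse L a ha ha0 hiso,
   fun h => lemma33bLandherr_of_normTheorem hNT L a ha ha0 h.1 h.2⟩

/-! ## Strength witness: the target implies a norm theorem -/

/-- **`Lemma33bLandherr` is genuinely arithmetic.**  It implies: every `σ`-fixed `x ∈ L` which is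
positive at every complex embedding is a sum of two norms `N(p) + N(q)` from `L` (apply the target to the
planes `⟨1,1⟩` and `⟨x, x⁻¹⟩`, which have equal signatures and equal discriminants, and read off the
`(0,0)` entry).  For `L = L₀(√-1)` this is "totally positive elements of `L₀` are sums of four squares"
(Siegel 1921), i.e. the norm theorem for `{-1,-1}` — so no proof of the target inside Mathlib v4.32.0
(which has no local–global principle for quadratic forms) should be expected, and option (ii) of the
brief (one cited arithmetic theorem) is the honest disposition. -/
theorem sumTwoNorms_of_lemma33bLandherr (hL : Lemma33bLandherr) (L : CMField) (x : L)
    (hx : conjRingHomK L x = x) (hpos : ∀ τ : L →+* ℂ, 0 < (τ x).re) :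
    ∃ p q : L, p * conjRingHomK L p + q * conjRingHomK L q = x := by
  have hx0 : x ≠ 0 := by
    obtain ⟨τ⟩ : Nonempty (L →+* ℂ) := inferInstance
    intro h
    have := hpos τ
    rw [h, map_zero, Complex.zero_re] at this
    exact lt_irrefl 0 this
  let a : Fin 4 → L := ![1, 1, x, x⁻¹]
  have ha : ∀ i, conjRingHomK L (a i) = a i := by
    intro i
    fin_cases i <;> simp [a, hx]
  have ha0 : ∀ i, a i ≠ 0 := by
    intro i
    fin_cases i <;> simp [a, hx0]
  have hsig : ∀ τ : L →+* ℂ,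
      ({decide (0 < (τ (a 0)).re), decide (0 < (τ (a 1)).re)} : Multiset Bool) =
        {decide (0 < (τ (a 2)).re), decide (0 < (τ (a 3)).re)} := by
    intro τ
    have h2 : 0 < (τ (a 2)).re := by simpa [a] using hpos τ
    have h3 : 0 < (τ (a 3)).re := by
      -- `τ(x⁻¹) = τ(x)⁻¹` and `τ x` is a positive real (`σ x = x` makes `τ x` real)
      have hreal : (starRingEnd ℂ) (τ x) = τ x := by
        rw [← embedding_conjRingHomK L τ x, hx]
      have him : (τ x).im = 0 := by
        have := congrArg Complex.im hreal
        simp only [Complex.conj_im] at this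
        linarith
      have hinv : (τ (a 3)).re = ((τ x).re)⁻¹ := by
        have e : a 3 = x⁻¹ := rfl
        rw [e, map_inv₀, Complex.inv_re, Complex.normSq_apply, him]
        have hr : (τ x).re ≠ 0 := (hpos τ).ne'
        field_simp
        ring
      rw [hinv]
      exact inv_pos.mpr (hpos τ)
    have h0 : 0 < (τ (a 0)).re := by simp [a]
    have h1 : 0 < (τ (a 1)).re := by simp [a]
    simp [h0, h1, h2, h3]
  have hdisc : ∃ z : L, z ≠ 0 ∧ a 0 * a 1 = a 2 * a 3 * (z * conjRingHomK L z) :=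
    ⟨1, one_ne_zero, by simp [a, mul_inv_cancel₀ hx0]⟩
  obtain ⟨g, hg⟩ := hL L a ha ha0 hsig hdisc
  have h00 := congrFun (congrFun hg 0) 0
  simp [Matrix.mul_apply, Fin.sum_univ_two, Matrix.diagonal, a] at h00
  refine ⟨(g : Matrix (Fin 2) (Fin 2) L) 0 0, (g : Matrix (Fin 2) (Fin 2) L) 1 0, ?_⟩
  linear_combination h00

end Literature

end HodgeCM

end
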